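import Literature.Analysis.FluidPDE.TurbPassiveScalar
import Literature.Analysis.FluidPDE.RenormalizedDiffusivityCascade
import Literature.Analysis.FluidPDE.UniversalTotalAnomalousDissipator
import HarnessLib

/-!
# Armstrong–Vicol: lack of selection in the vanishing-diffusivity limit (Prop. 5.5)

S. Armstrong, V. Vicol, *Anomalous diffusion by fractal homogenization*, Ann. PDE **11** (2025),
Paper No. 2 = arXiv:2305.05048v3 (9 Oct 2024), **§5.5 "Lack of selection in the vanishing diffusivity
limit"**, Proposition 5.5 p. 93, proof pp. 94–100 (Lemma 5.6 p. 94, Lemma 5.7 p. 95, conditions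
(5.135)–(5.140) p. 99, conclusion (5.141)–(5.142) p. 100). [`ArmstrongVicol2025`; the section is new in
arXiv v3 = the journal version; all locators page-confirmed on the v3 PDF, 2026-08-27.]

This is the companion of `TurbPassiveScalar.lean` (Thm. 1.1: `armstrong_vicol`,
`ArmstrongVicol2025_thm11_full`, `ArmstrongVicol2025_thm11_rate`, clause predicates
`ArmstrongVicol2025.IsCarrier` / `.DissipatesAlongIntervals`) and of
`RenormalizedDiffusivityCascade.lean` (the parameters `qExp` (2.2), `gammaExp` (2.7), `deltaExp` (2.5)
and the printed scales `scaleSeq Λ q m = εₘ` (2.8)), whose vocabulary is reused and never redeclared.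
The docstring of `ArmstrongVicol2025_thm11_full` records that the lack-of-selection statement was left
out there because "Prop. 5.5 p. 93 concerns a construction-dependent class of `Ḣ²(T²)` data"; with the
parameter vocabulary of `RenormalizedDiffusivityCascade.lean` in the tree that class now has a
self-contained typed form (`ArmstrongVicol2025.InSelectionClass` below), and Prop. 5.5 is vendored as
printed.

**Proposition 5.5** (p. 93, verbatim). "Fix `β ∈ [68/67, 4/3)`. There exists a constant
`C⋆ = C⋆(β) ≥ 1` such that the following holds. For every parameters `A ∈ (0,1]` and `B > 1`, assume that
`Λ` is taken sufficiently large with respect to `β, A, B` to ensure that (see condition (5.138) below):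
`C⋆ Λ^{-δ} ≤ min{A, B^{-(2/(2+γ))(2-β+2β/(q+1))}}`. Fix the sequence `{εₘ}_{m≥0}` according to (2.8).
Choose an initial datum `θ₀ ∈ Ḣ²(T²)`. Define the length scale `L_{θ₀} := ‖θ₀‖_{L²(T²)}/‖∇θ₀‖_{L²(T²)}`
and let `m⋆ ≥ 1` be the unique integer such that `ε_{m⋆} ≤ C⋆ L_{θ₀}^{2/(2+γ-2qδ)} < ε_{m⋆-1}`. Assuming
that `θ₀` satisfies (see conditions (5.139) and (5.140) below):
`‖∇θ₀‖⁴_{L²(T²)} / (‖θ₀‖²_{L²(T²)} ‖Δθ₀‖²_{L²(T²)}) ≥ A`, and `C⋆ L_{θ₀}^{2/(2+γ-2qδ)} ≤ B ε_{m⋆}`,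
there exist two sequences of diffusivities `{κₘ⁽¹⁾}_{m∈ℕ}` and `{κₘ⁽²⁾}_{m∈ℕ}`, both converging to `0`
as `m → ∞`, such that the corresponding solutions `{θ^{κₘ⁽¹⁾}}ₘ` and `{θ^{κₘ⁽²⁾}}ₘ` of the
advection-diffusion equation with initial data `θ₀` and drift `b`, converge as `m → ∞` in
`C^{0,μ}((0,1); L²(T²))` (for some `μ > 0`) to two distinct weak solutions of the associated transport
equation." (The section opens: "Our result applies to a large class of `Ḣ²(T²)` initial conditions, but
not to all of them.")

Here `q = q(β)` is (2.2), `γ` is (2.7), `δ` is (2.5) (`ArmstrongVicol2025.qExp`, `.gammaExp`,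
`.deltaExp`), `εₘ = εₘ(Λ, q)` is (2.8) (`ArmstrongVicol2025.scaleSeq`), `Λ ∈ ℕ ∩ [2⁷, ∞)` is the minimal
scale separation (§2.1 p. 19), `b` is the vector field (2.38) of the paper built with these parameters
(`α = β - 1` in Thm. 1.1, (2.1) p. 18) and `θ^κ` is the unique solution in `C([0,1]; L²(T²))` of
`∂ₜθ + b·∇θ = κΔθ`, `θ(0) = θ₀` (Thm. 1.1 p. 3). End of the proof (p. 100): "the sequences
`{θ^{κₘ⁽¹⁾}}_{m≥m⋆}` and `{θ^{κₘ⁽²⁾}}_{m≥m⋆}` are Cauchy in `L^∞([0,1]; L²(T²))`; in fact, in light of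
(5.108) they are Cauchy sequences in `C^{0,μ/2}([0,1]; L²(T²))`. Clearly, these two sequences have
different limits due to (5.142) [`|‖θ^{κₘ⁽¹⁾}(t,·)‖_{L²} - ‖θ^{κₘ⁽²⁾}(t,·)‖_{L²}| ≥ ½C(β,L_{θ₀})‖θ₀‖_{L²} > 0`
for some `t ∈ [0,1]` and all `m` sufficiently large]. Moreover, these limit points are weak solutions
of the transport equation with velocity field `b`, and belong to `C^{0,μ/2}([0,1]; L²(T²))`."

## Contents

* `Torus.eScalarLaplacianNormSq θ` — **definition** (plumbing): the spectral `‖Δθ‖²_{L²} ∈ [0,∞]` of a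
  real scalar on `T^d`, `16π⁴ ∑ₖ |k|⁴ |θ̂(k)|²` (the scalar twin of `Turb.eLaplacianNormSq`; same
  conventions as `Torus.eScalarGradNormSq = 4π² ∑ |k|² |θ̂(k)|²`).
* `ArmstrongVicol2025.selectionExponent β` — **definition**: the exponent `2/(2+γ-2qδ)` of Prop. 5.5
  with `q = qExp β`, `γ = gammaExp β q`, `δ = deltaExp β q`.
* `ArmstrongVicol2025.InSelectionClass β C⋆ A B Λ θ₀` — **definition**: the data class of Prop. 5.5
  (mean-zero `θ₀ ∈ H²(T^d)`, (5.139), and the length-scale window (5.140) with its `m⋆ ≥ 1`).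
* `ArmstrongVicol2025.TendstoInHolderL2 μ u θ₀ κ ϑ` — **definition**: "the solutions `θ^{κₘ}` converge to
  `ϑ` in `C^{0,μ}([0,1]; L²)`".
* `ArmstrongVicol2025.LacksSelectionAt u θ₀` — **definition**: the conclusion of Prop. 5.5 for one datum.
* `ArmstrongVicol2025_prop55` — **named fact**: Prop. 5.5 as printed, for the carrier of Thm. 1.1.

## Rendering (faithfulness notes)

* Solutions. As in `TurbPassiveScalar.lean`, "the solution `θ^κ`" (`κ > 0`) is rendered by quantifying
  over all weak solutions `Torus.IsWeakScalarTransportOn 1 κ u θ₀ θ` on `T² × [0,1)` which are the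
  `C([0,1]; L²(T²))` representative (`Torus.IsL2ContinuousOn (Icc 0 1) θ`, the class printed in Thm. 1.1;
  needed because time slices `θ(t)` are evaluated). The limits `ϑ⁽ⁱ⁾` are weak solutions of the transport
  equation (`κ = 0`) with datum `θ₀` on `[0,1)` lying in `C([0,1]; L²(T²))` (p. 100).
* Convergence "in `C^{0,μ}((0,1); L²(T²))`" is typed as convergence to `0` of the `C^{0,μ}([0,1]; L²)`
  norm of the difference: for every `ε > 0`, eventually in `m`, both `sup_t ‖θ^{κₘ}(t) - ϑ(t)‖²_{L²} ≤ ε`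
  and the squared `μ`-Hölder seminorm in time of `θ^{κₘ} - ϑ` is `≤ ε` (`Torus.scalarL2Sq`). On
  continuous representatives `(0,1)` and `[0,1]` give the same norm; `[0,1]` is what the proof prints
  (p. 100).
* "Two distinct weak solutions": `ϑ⁽¹⁾(t) ≠ ϑ⁽²⁾(t)` in `L²(T²)` (not a.e. equal) for some `t ∈ [0,1]`
  — for `C([0,1]; L²)` functions this is distinctness; (5.142) gives it through the `L²` norms.
* `m⋆`: "the unique integer `m⋆ ≥ 1` such that `ε_{m⋆} ≤ C⋆L^{p} < ε_{m⋆-1}`" exists iff `C⋆L^{p} < ε₀ = 1`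
  and is then unique (`εₘ ↓ 0`); typed as `∃ m⋆ ≥ 1` with the two-sided bound, together with (5.140)
  `C⋆L^{p} ≤ Bε_{m⋆}` — data for which no such `m⋆` exists are outside the class, as in print.
* `L_{θ₀} = ‖θ₀‖_{L²}/‖∇θ₀‖_{L²}` as printed in the Proposition (p. 93; the proof, p. 98, refers to
  (5.103), where the denominator is `‖θ₀‖_{H¹}` — equivalent up to a factor in `[1, (1+1/(4π²))^{1/2}]`
  for mean-zero data; the Proposition's own definition is the one typed), rendered through the identity
  `‖θ₀‖²_{L²} = ℓ² ‖∇θ₀‖²_{L²}` in `ℝ≥0∞` with the spectral `Torus.eScalarGradNormSq` (the convention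
  of `ArmstrongVicol2025.DissipatesAtRate`), for `θ₀ ≠ 0` (`0 < ‖θ₀‖²_{L²}`, so that `ℓ = L_{θ₀}` is
  determined; the printed `L_{θ₀}` presupposes `∇θ₀ ≠ 0`).
* (5.139) multiplicatively in `ℝ≥0∞`: `A ‖θ₀‖²_{L²} ‖Δθ₀‖²_{L²} ≤ (‖∇θ₀‖²_{L²})²`.
* "`Λ` sufficiently large with respect to `β, A, B`" (ensuring (5.138); Lemma 5.6 and (5.113)–(5.114)
  enlarge `Λ` further, depending on `β` only): `∃ Λ₀, ∀ Λ ≥ Λ₀` with `Λ ∈ ℕ` as in (2.8); the displayed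
  inequality is a consequence of the largeness and is not typed separately.
* The drift. Prop. 5.5 is about THE vector field `b` of the paper ((2.38)), for which Thm. 1.1 is proved
  in §5.4 immediately before (every requirement on `Λ` in the paper is a lower bound depending on `β`,
  §2.1 p. 19 "`Λ` … will be chosen to depend only on `β`", so the larger `Λ` of Prop. 5.5 keeps Thm. 1.1);
  the fact therefore asserts, for one `u`, the carrier class `ArmstrongVicol2025.IsCarrier (β-1)`
  ((1.2)–(1.3), `α = β - 1` by (2.1)), the conclusion of Thm. 1.1 along its intervals
  (`∃ κ, ArmstrongVicol2025.DissipatesAlongIntervals u κ`, exactly the clause of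
  `ArmstrongVicol2025_thm11_full`) AND the lack of selection — the same bundling as
  `ArmstrongVicol2025_rmk54`. Dimension `d = 2` (`T²`), as printed for §5.
* Not transcribed (proof-internal, quoted for consumers): the two sequences lie in the permissible set
  `K` of (3.43), `κₘ⁽ⁱ⁾ ∈ [½ εₘ^{2β/(q+1)}, 2 εₘ^{2β/(q+1)}]` with `5/4 ≤ max{κₘ⁽¹⁾/κₘ⁽²⁾, κₘ⁽²⁾/κₘ⁽¹⁾} ≤ 2`
  (p. 94, (5.122)–(5.123) p. 96); Lemma 5.7 p. 95 (short-time separation of the `L²` norms of two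
  solutions with diffusivities `κ⁽¹⁾ ≤ ⅘κ⁽²⁾` under a smooth incompressible drift) is an internal lemma
  with a proof sketch ("standard energy estimates") and is not vendored.

No new notion of solution, norm or function space is introduced: `Torus.eScalarLaplacianNormSq` is the
scalar copy of the tree's `Turb.eLaplacianNormSq` (vector fields) and everything else is a clause
predicate spelling out the printed text over existing vocabulary.
-/

open MeasureTheory Set Filter Topology
open scoped ENNReal NNReal

namespace Literature.Analysis.FluidPDE

noncomputable section

namespace Torus

variable {d : Type*} [Fintype d]

/-- The spectral squared `L²` norm of the Laplacian of a real scalar on `T^d`,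
`‖Δθ‖²_{L²} = 16π⁴ ∑_{k ≠ 0} |k|⁴ |θ̂(k)|² ∈ [0, ∞]`, via the homogeneous `Ḣ²` seminorm of `θ` viewed in
`ℂ` (`FunctionSpaces.Torus.eHomSobolevSeminorm 2`; characters `e^{2πi k·x}`, `Δ e^{2πik·x} =
-4π²|k|² e^{2πik·x}`, whence `(4π²)²`). Scalar twin of `Turb.eLaplacianNormSq`; companion of
`Torus.eScalarGradNormSq = 4π² ∑ |k|² |θ̂(k)|²` (same junk convention: Fourier coefficients of a
non-integrable `θ` are `0`; the value is `∞` for `θ ∉ H²`). Used for the `‖Δθ₀‖_{L²(T²)}` of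
Armstrong–Vicol, Prop. 5.5 (5.139). [folklore] -/
def eScalarLaplacianNormSq (θ : UnitAddTorus d → ℝ) : ℝ≥0∞ :=
  ENNReal.ofReal (16 * Real.pi ^ 4) *
    FunctionSpaces.Torus.eHomSobolevSeminorm 2 (fun x => (θ x : ℂ)) ^ 2

end Torus

namespace ArmstrongVicol2025

variable {d : Type*} [Fintype d] [DecidableEq d]

/-- **The length-scale exponent of Prop. 5.5**: `2/(2 + γ - 2qδ)` with `q = q(β)` of (2.2),
`γ = (q-1)β/(q+1)` of (2.7) and `δ` of (2.5) (`qExp`, `gammaExp`, `deltaExp` of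
`RenormalizedDiffusivityCascade.lean`); `2 + γ - 2qδ > 0` for all `β ∈ (1, 4/3)` (p. 98).
[cite: ArmstrongVicol2025, Prop. 5.5 p. 93; (5.133), (5.137) pp. 98–99] -/
def selectionExponent (β : ℝ) : ℝ :=
  2 / (2 + gammaExp β (qExp β) - 2 * qExp β * deltaExp β (qExp β))

/-- **The data class of Armstrong–Vicol's Prop. 5.5** for the parameters `β` (Hölder exponent
`α = β - 1`), `C⋆ ≥ 1`, `A ∈ (0,1]`, `B > 1` and the minimal scale separation `Λ ∈ ℕ` (p. 93: "Fix the
sequence `{εₘ}_{m≥0}` according to (2.8). Choose an initial datum `θ₀ ∈ Ḣ²(T²)`. Define the length scale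
`L_{θ₀} := ‖θ₀‖_{L²(T²)}/‖∇θ₀‖_{L²(T²)}` and let `m⋆ ≥ 1` be the unique integer such that
`ε_{m⋆} ≤ C⋆ L_{θ₀}^{2/(2+γ-2qδ)} < ε_{m⋆-1}`. Assuming that `θ₀` satisfies (see conditions (5.139) and
(5.140) below): `‖∇θ₀‖⁴_{L²(T²)} / (‖θ₀‖²_{L²(T²)} ‖Δθ₀‖²_{L²(T²)}) ≥ A`, and
`C⋆ L_{θ₀}^{2/(2+γ-2qδ)} ≤ B ε_{m⋆}` …"; p. 99: "it is the upper bound in (5.140) which is the assumption,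
and it states that this upper bound matches the lower bound up to some a-priori fixed constant").
Typed reading (module docstring, *Rendering*): `θ₀ ∈ H²(T^d)` (`FunctionSpaces.Torus.MemSobolev 2` of the
complexified scalar) with zero mean and `θ₀ ≠ 0` (`0 < ‖θ₀‖²_{L²}`); (5.139) as
`A ‖θ₀‖²_{L²} ‖Δθ₀‖²_{L²} ≤ (‖∇θ₀‖²_{L²})²` (`Torus.scalarL2Sq`, spectral `Torus.eScalarGradNormSq`,
`Torus.eScalarLaplacianNormSq`); the length scale `ℓ = L_{θ₀} > 0` through
`‖θ₀‖²_{L²} = ℓ² ‖∇θ₀‖²_{L²}` (as in `DissipatesAtRate`); and the window: some `m⋆ ≥ 1` with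
`ε_{m⋆} ≤ C⋆ ℓ^p < ε_{m⋆-1}` and `C⋆ ℓ^p ≤ B ε_{m⋆}`, `p = selectionExponent β`,
`εₘ = scaleSeq Λ (qExp β) m` ((2.8), `ε₀ = 1`).
[cite: ArmstrongVicol2025, Prop. 5.5 p. 93; (5.139)–(5.140) p. 99] -/
def InSelectionClass (β Cstar A B : ℝ) (Λ : ℕ) (θ₀ : UnitAddTorus d → ℝ) : Prop :=
  FunctionSpaces.Torus.MemSobolev 2 (fun x => (θ₀ x : ℂ)) ∧
  FunctionSpaces.Torus.HasZeroMean θ₀ ∧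
  0 < Torus.scalarL2Sq θ₀ ∧
  -- (5.139): `‖∇θ₀‖⁴ / (‖θ₀‖² ‖Δθ₀‖²) ≥ A`
  ENNReal.ofReal A * (ENNReal.ofReal (Torus.scalarL2Sq θ₀) * Torus.eScalarLaplacianNormSq θ₀) ≤
    Torus.eScalarGradNormSq θ₀ ^ 2 ∧
  -- the length scale `ℓ = ‖θ₀‖_{L²}/‖∇θ₀‖_{L²}`, its level `m⋆ ≥ 1`, and (5.140)
  ∃ ℓ : ℝ, 0 < ℓ ∧
    ENNReal.ofReal (Torus.scalarL2Sq θ₀) = ENNReal.ofReal (ℓ ^ 2) * Torus.eScalarGradNormSq θ₀ ∧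
    ∃ mstar : ℕ, 1 ≤ mstar ∧
      scaleSeq Λ (qExp β) mstar ≤ Cstar * ℓ ^ selectionExponent β ∧
      Cstar * ℓ ^ selectionExponent β < scaleSeq Λ (qExp β) (mstar - 1) ∧
      Cstar * ℓ ^ selectionExponent β ≤ B * scaleSeq Λ (qExp β) mstar

/-- **Convergence of the vanishing-diffusivity solutions in `C^{0,μ}([0,1]; L²(T^d))`** along a sequence
of diffusivities `κₘ`, to a scalar `ϑ`, for the drift `u` and the datum `θ₀` (Prop. 5.5 p. 93: "the
corresponding solutions `{θ^{κₘ⁽ⁱ⁾}}ₘ` … converge as `m → ∞` in `C^{0,μ}((0,1); L²(T²))`"; p. 100: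
"Cauchy sequences in `C^{0,μ/2}([0,1]; L²(T²))`"): for every `ε > 0`, for all sufficiently large `m`,
every weak solution `θ` of `∂ₜθ + u·∇θ = κₘΔθ`, `θ(0) = θ₀` on `T^d × [0,1)` which is the
`C([0,1]; L²)` representative (`Torus.IsL2ContinuousOn`; "the corresponding solution `θ^{κₘ}`", unique in
that class) satisfies, for all `s, t ∈ [0,1]`: `‖θ(t) - ϑ(t)‖²_{L²} ≤ ε` and
`‖(θ(t) - ϑ(t)) - (θ(s) - ϑ(s))‖²_{L²} ≤ ε |t-s|^{2μ}` — i.e. the squared `C^{0,μ}([0,1]; L²)` norm of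
`θ^{κₘ} - ϑ` (sup part and `μ`-Hölder seminorm in time, `Torus.scalarL2Sq`) tends to `0`
(module docstring, *Rendering*). [cite: ArmstrongVicol2025, Prop. 5.5 p. 93; proof p. 100] -/
def TendstoInHolderL2 (μ : ℝ) (u : ℝ → UnitAddTorus d → EuclideanSpace ℝ d)
    (θ₀ : UnitAddTorus d → ℝ) (κ : ℕ → ℝ) (ϑ : ℝ → UnitAddTorus d → ℝ) : Prop :=
  ∀ ε : ℝ, 0 < ε → ∀ᶠ m in atTop, ∀ θ : ℝ → UnitAddTorus d → ℝ,
    Torus.IsWeakScalarTransportOn 1 (κ m) u θ₀ θ → Torus.IsL2ContinuousOn (Icc 0 1) θ →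
      ∀ s ∈ Icc (0 : ℝ) 1, ∀ t ∈ Icc (0 : ℝ) 1,
        Torus.scalarL2Sq (θ t - ϑ t) ≤ ε ∧
        Torus.scalarL2Sq ((θ t - ϑ t) - (θ s - ϑ s)) ≤ ε * |t - s| ^ (2 * μ)

/-- **The conclusion of Armstrong–Vicol's Prop. 5.5 for one datum** `θ₀` and the drift `u` (p. 93:
"there exist two sequences of diffusivities `{κₘ⁽¹⁾}_{m∈ℕ}` and `{κₘ⁽²⁾}_{m∈ℕ}`, both converging to `0`
as `m → ∞`, such that the corresponding solutions … converge as `m → ∞` in `C^{0,μ}((0,1); L²(T²))`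
(for some `μ > 0`) to two distinct weak solutions of the associated transport equation"; p. 100: "these
limit points are weak solutions of the transport equation with velocity field `b`, and belong to
`C^{0,μ/2}([0,1]; L²(T²))`", distinct by (5.142)): two positive null sequences `κ⁽¹⁾, κ⁽²⁾`, two weak
solutions `ϑ⁽¹⁾, ϑ⁽²⁾` of the transport equation (`κ = 0`) with datum `θ₀` on `T^d × [0,1)`, both in
`C([0,1]; L²)`, with `ϑ⁽¹⁾(t) ≠ ϑ⁽²⁾(t)` in `L²` (not a.e. equal) for some `t ∈ [0,1]`, and one `μ > 0`
with `θ^{κₘ⁽ⁱ⁾} → ϑ⁽ⁱ⁾` in `C^{0,μ}([0,1]; L²)` for `i = 1, 2` (`TendstoInHolderL2`).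
[cite: ArmstrongVicol2025, Prop. 5.5 p. 93; proof (5.141)–(5.142) p. 100] -/
def LacksSelectionAt (u : ℝ → UnitAddTorus d → EuclideanSpace ℝ d) (θ₀ : UnitAddTorus d → ℝ) :
    Prop :=
  ∃ κ₁ κ₂ : ℕ → ℝ, (∀ m, 0 < κ₁ m) ∧ (∀ m, 0 < κ₂ m) ∧
    Tendsto κ₁ atTop (𝓝 0) ∧ Tendsto κ₂ atTop (𝓝 0) ∧
    ∃ ϑ₁ ϑ₂ : ℝ → UnitAddTorus d → ℝ,
      Torus.IsWeakScalarTransportOn 1 0 u θ₀ ϑ₁ ∧ Torus.IsWeakScalarTransportOn 1 0 u θ₀ ϑ₂ ∧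
      Torus.IsL2ContinuousOn (Icc 0 1) ϑ₁ ∧ Torus.IsL2ContinuousOn (Icc 0 1) ϑ₂ ∧
      (∃ t ∈ Icc (0 : ℝ) 1, ¬ (ϑ₁ t =ᵐ[volume] ϑ₂ t)) ∧
      ∃ μ : ℝ, 0 < μ ∧ TendstoInHolderL2 μ u θ₀ κ₁ ϑ₁ ∧ TendstoInHolderL2 μ u θ₀ κ₂ ϑ₂

end ArmstrongVicol2025

/-- **Armstrong–Vicol, Prop. 5.5 (lack of selection in the vanishing diffusivity limit)** (Ann. PDE 11
(2025) = arXiv:2305.05048v3, §5.5 p. 93; proof pp. 94–100), for the carrier of Thm. 1.1 on `T²`.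
Verbatim statement and the typed reading of each clause: module docstring and the clause predicates
`ArmstrongVicol2025.InSelectionClass` (the `Ḣ²` data class (5.139)–(5.140)),
`ArmstrongVicol2025.LacksSelectionAt` (two vanishing sequences of diffusivities whose solutions converge
in `C^{0,μ}([0,1];L²(T²))` to two distinct weak solutions of the transport equation).
Typed form: for every `β ∈ [68/67, 4/3)` there is `C⋆ ≥ 1` such that for all `A ∈ (0,1]`, `B > 1`
there is `Λ₀` such that for every minimal scale separation `Λ ≥ Λ₀` (`Λ ∈ ℕ`, (2.8)) there is a velocity
field `u : ℝ × T² → ℝ²` — the field `b` of (2.38) built with `β, Λ` — which (i) lies in the carrier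
class of Thm. 1.1 (`ArmstrongVicol2025.IsCarrier (β-1)`: `1`-periodic in time,
`C⁰_t C^{0,β-1}_x ∩ C^{0,β-1}_t C⁰_x`, weakly divergence free; `α = β - 1` by (2.1) p. 18), (ii) satisfies
the conclusion of Thm. 1.1 along its intervals (`∃ κ, ArmstrongVicol2025.DissipatesAlongIntervals u κ`;
bundled because Prop. 5.5 concerns the same `b`, for which Thm. 1.1 is proved in §5.4 with every
requirement on `Λ` a `β`-dependent lower bound — module docstring, *The drift*; the bundling of
`ArmstrongVicol2025_rmk54`), and (iii) lacks selection on the class: every `θ₀` with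
`ArmstrongVicol2025.InSelectionClass β C⋆ A B Λ θ₀` satisfies `ArmstrongVicol2025.LacksSelectionAt u θ₀`.
"`Λ` sufficiently large with respect to `β, A, B`" is `∃ Λ₀ ∀ Λ ≥ Λ₀`; the displayed consequence
`C⋆Λ^{-δ} ≤ min{A, B^{-(2/(2+γ))(2-β+2β/(q+1))}}` ((5.138) p. 99) is not typed separately. No weakening
of the printed logical content is intended; readings (continuous representatives, "distinct" as not a.e.
equal at some time, `m⋆` existential, `L_{θ₀}` as defined in the Proposition) are listed in the module
docstring. [cite: ArmstrongVicol2025, Prop. 5.5 p. 93; (5.138)–(5.140) p. 99; (5.141)–(5.142) p. 100; Thm. 1.1 p. 3; (2.1), (2.8) pp. 18–19] -/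
def ArmstrongVicol2025_prop55 : Prop :=
  ∀ β : ℝ, 68 / 67 ≤ β → β < 4 / 3 →
    ∃ Cstar : ℝ, 1 ≤ Cstar ∧
      ∀ A : ℝ, 0 < A → A ≤ 1 → ∀ B : ℝ, 1 < B →
        ∃ Λ₀ : ℕ, ∀ Λ : ℕ, Λ₀ ≤ Λ →
          ∃ u : ℝ → UnitAddTorus (Fin 2) → EuclideanSpace ℝ (Fin 2),
            ArmstrongVicol2025.IsCarrier (β - 1).toNNReal u ∧
            (∃ κ : ℕ → ℝ, ArmstrongVicol2025.DissipatesAlongIntervals u κ) ∧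
            ∀ θ₀ : UnitAddTorus (Fin 2) → ℝ,
              ArmstrongVicol2025.InSelectionClass β Cstar A B Λ θ₀ →
                ArmstrongVicol2025.LacksSelectionAt u θ₀

end

end Literature.Analysis.FluidPDE
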